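import Summits.BirchSwinnertonDyer.Rank1Residual.X2.GreenbergVatsalTateKummerLocal
import Literature.NumberTheory.EllipticCurves.TateCurve.NumberFieldUniformization
import Literature.NumberTheory.EllipticCurves.KummerSelmerStructure
import HarnessLib

/-!
# At a KUMMER place the Kummer-character class `[σ ↦ χ(σ)·P̃]` is a Kummer class for EVERY `χ`:
# rational `p`-torsion lies on the Tate line when `p ∤ ord_v j(E)`, and Hilbert 90 through the Tate
# parametrisation
# (route `EisensteinPrimes`, crux 3 `MazurMCOnCellB` = stmt-BirchSwinnertonDyer-19033, line `mudescent`,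
# stub 4″ `stub_lambdaCountWeak_offLocus`, ALGEBRAIC half; width seat bsd-line-x2-p1-w3, D-0154 row 5)

HONEST FRAMING (cell `bsd-eis`; nothing here proves BSD or a main conjecture; 0 cells move): THEOREMS
ONLY — no definition, no named fact, nothing asserted about any particular curve, closes nothing. FILE 2
of 3 of the «Kummer-character classes» helper (FILE 1 `…KummerCharacterCocycles`, FILE 3
`…KummerCharacterCount`). A KUMMER place of `(E, P)` (`P` a rational point of order `p`) is a finite
place `v` of SPLIT multiplicative reduction with `p ∤ ord_v(j(E)) = −ord_v(Δ_min)` (the cell's «Kummer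
support», lam-a `EisensteinPrimesKummerPartners.kummerSupport`: the bad primes where `E[p]` is RAMIFIED;
over `ℚ` necessarily `ℓ ≡ 1 (mod p)` or `ℓ = p`). There the LEAD's census found «no local-kernel class»
(`ker r_η = 0`): the local condition admits no relaxation. What this file proves is the complementary
GLOBAL mechanism: at such a place the rational `p`-torsion point lies on the Tate line `Φ(μ_p)`, so the
localisation of `σ ↦ χ(σ)·P̃` takes values in `Φ(μ_{p^∞})` and is a Kummer coboundary for EVERY
character `χ` of `Γ_{K_v}` — ramified or not. Kummer places are places of FREE ramification for the
Kummer-character classes (FILE 3 counts them).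

* §1 `exists_tateUniformisation_val_eq` — Tate's `v`-adic uniformisation at a split multiplicative
  place WITH the clause `v(q) = v(j(E))⁻¹` (the tree's discharged named fact
  `Silverman1994_thmV53_tateUniformisation` forgets it; same assembly from
  `exists_tateParameter_of_hasSplitMultiplicativeReductionAt` + `uniformization_holds` +
  `localPointsEquivTate`); `exists_rootOfUnity_map_eq_of_fixed` — if `v(j)` is not a `p`-th power in
  the value group, every `Γ_{K_v}`-fixed `P ∈ E(K̄_v)` with `p·P = 0` is `Φ(ζ)`, `ζ ∈ μ_p(K_v)`
  (`P = Φ(u)`, `u ∈ K_vˣ`, `u^p = q^b`; `p ∣ b` gives `ζ = u q^{−b/p}`, `p ∤ b` would make `q`, hence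
  `v(j)`, a `p`-th power).
* §2 `res_oneCocycleClass_mem_kummerLocalConditionAt_of_split` — THE KUMMER PLACE LEMMA: for a global
  crossed homomorphism `φ` with `φ(res σ) = χ_v(σ)·P̃` on `Γ_{K_v}` (`χ_v` ANY continuous character of
  `Γ_{K_v}`), `res_v [φ]` lies in `ker(H¹(K_v, E[p]) → H¹(K_v, E(K̄_v)))`: the datum
  `τ ↦ χ_v(τ)·P̃ = Φ(ζ^{χ_v(τ)})` has values in the roots of unity of the Tate parametrisation, and
  such a cocycle is `τ ↦ τ•Φ(u) − Φ(u)` by continuous Hilbert 90 (tree: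
  `X2.GreenbergVatsalTateKummerLocal.exists_point_of_values_in_roots`, Greenberg LNM 1716 p. 76
  «verified quite directly by using the Tate parametrization»).

References: [SilvermanATAEC1994] Thm. V.3.1 (c)(d), Thm. V.5.3; [GreenbergLNM1716] §2 pp. 75–76, §5
proof of Prop. 5.10; [GreenbergVatsal2000] §2 pp. 14–15; [SerreLocalFields1979] X §1 Prop. 2.
-/

set_option autoImplicit false
-- `Summit.BirchSwinnertonDyer.BirchSwinnertonDyer.…`: the summit and its single sub-problem share a name (D-0017 layout).
set_option linter.dupNamespace false

noncomputable section

open scoped Classical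

open Function Field NumberField IsDedekindDomain WeierstrassCurve
  Literature.NumberTheory.EllipticCurves Literature.NumberTheory.GaloisRepresentations
  Summit.BirchSwinnertonDyer.Rank1Residual

namespace Summit.BirchSwinnertonDyer.BirchSwinnertonDyer.Theorems.EisensteinPrimesMazurMCOnCellBKummerPlaceClasses

/-! ## §1. Tate's uniformisation WITH the valuation of `q` (`v(q) = v(j)⁻¹`); rational `p`-torsion on the Tate line -/

section Tate

open Literature.NumberTheory.EllipticCurves.TateCurve

variable {K : Type} [Field K] [NumberField K] (W : WeierstrassCurve K) [W.IsElliptic] {p : ℕ}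
  [hp : Fact p.Prime] (v : HeightOneSpectrum (𝓞 K))

omit hp in
/-- **Tate's `v`-adic uniformisation at a place of split multiplicative reduction, with the
valuation of the Tate parameter recorded: `v(q) = v(j(E))⁻¹`.** The tree's DISCHARGED named fact
`Silverman1994_thmV53_tateUniformisation` (`TateCurve.Silverman1994_thmV53_tateUniformisation_holds`)
forgets the clause `‖q‖ = ‖j(E)‖_v⁻¹` of `exists_tateParameter_of_hasSplitMultiplicativeReductionAt`
(ATAEC V.5.3: `j(E_q) = j(E)`, `|j(E)|_v = |q|_v⁻¹`); this is the same assembly keeping it (the five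
printed properties of `Φ : K̄_vˣ → E(K̄_v)` verbatim as in the named fact: surjective, kernel `q^ℤ`,
`Γ_{K_v}`-equivariant, fixed points from `K_vˣ`).
-- adapted from Literature/NumberTheory/EllipticCurves/TateCurve/NumberFieldUniformization.lean
[cite: SilvermanATAEC1994, Thm. V.5.3 (PDF pp. 407–409) and Thm. V.3.1 (c)(d) (PDF p. 395)] -/
theorem exists_tateUniformisation_val_eq (hsplit : W.HasSplitMultiplicativeReductionAt v) :
    ∃ (q : v.adicCompletion K)
      (Φ : Additive (AlgebraicClosure (v.adicCompletion K))ˣ →+ localPoints W (v.adicCompletion K)),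
      q ≠ 0 ∧ Valued.v q < 1 ∧
      Valued.v q = (Valued.v (algebraMap K (v.adicCompletion K) W.j))⁻¹ ∧
      Function.Surjective Φ ∧
      (∀ u : (AlgebraicClosure (v.adicCompletion K))ˣ, Φ (Additive.ofMul u) = 0 ↔
        ∃ n : ℤ, (u : AlgebraicClosure (v.adicCompletion K)) =
          algebraMap (v.adicCompletion K) (AlgebraicClosure (v.adicCompletion K)) q ^ n) ∧
      (∀ (σ : absoluteGaloisGroup (v.adicCompletion K))
          (u : (AlgebraicClosure (v.adicCompletion K))ˣ),
        σ • Φ (Additive.ofMul u) =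
          Φ (Additive.ofMul (Units.map
            (Field.absoluteGaloisGroup.toAlgEquiv (v.adicCompletion K) σ :
              AlgebraicClosure (v.adicCompletion K) →* AlgebraicClosure (v.adicCompletion K))
            u))) ∧
      (∀ P : localPoints W (v.adicCompletion K),
        (∀ σ : absoluteGaloisGroup (v.adicCompletion K), σ • P = P) →
        ∃ u : (v.adicCompletion K)ˣ,
          Φ (Additive.ofMul (Units.map (algebraMap (v.adicCompletion K)
            (AlgebraicClosure (v.adicCompletion K)) : v.adicCompletion K →*
              AlgebraicClosure (v.adicCompletion K)) u)) = P) := by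
  haveI := charZero_adicCompletion' K v
  letI := Literature.NumberTheory.GaloisRepresentations.Ultrametric.AdicCompletion.nontriviallyNormedField K v
  -- V.5.3: the Tate parameter (with its valuation) and the `K_v`-isomorphism `C • (W ⊗ K_v) = E_q`
  obtain ⟨q, hq0, hq, -, hqn, C, hC⟩ :=
    exists_tateParameter_of_hasSplitMultiplicativeReductionAt K v W hsplit
  -- V.3.1 (c)(d): Tate's `φ` over `K̄_v`
  obtain ⟨φ, hsurj, hker, hequiv, hrat⟩ := uniformization_holds q hq0 hq
  let e := localPointsEquivTate W v C hC
  have hj0 : algebraMap K (v.adicCompletion K) W.j ≠ 0 := by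
    intro h
    rw [h, norm_zero, inv_zero, norm_eq_zero] at hqn
    exact hq0 hqn
  refine ⟨q, e.symm.toAddMonoidHom.comp φ, hq0, ?_, ?_, ?_, ?_, ?_, ?_⟩
  · exact (Valued.toNormedField.norm_lt_one_iff).mp hq
  · -- `‖q‖ = ‖j‖⁻¹ = ‖j⁻¹‖`, and the norm is an order embedding of the valuation
    rw [← norm_inv] at hqn
    rw [← map_inv₀]
    refine le_antisymm ?_ ?_
    · exact (Valued.toNormedField.norm_le_iff).mp hqn.le
    · exact (Valued.toNormedField.norm_le_iff).mp hqn.ge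
  · exact e.symm.surjective.comp hsurj
  · intro u
    rw [← hker u]
    change e.symm (φ (Additive.ofMul u)) = 0 ↔ _
    rw [AddEquiv.map_eq_zero_iff]
  · intro σ u
    change σ • e.symm (φ (Additive.ofMul u)) = e.symm (φ _)
    rw [← hequiv σ u]
    apply e.injective
    rw [AddEquiv.apply_symm_apply, localPointsEquivTate_smul, AddEquiv.apply_symm_apply]
  · intro P hP
    have hP' : ∀ σ : absoluteGaloisGroup (v.adicCompletion K),
        absoluteGaloisGroup.toAlgEquiv (v.adicCompletion K) σ ∈
          (⊥ : IntermediateField (v.adicCompletion K)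
            (AlgebraicClosure (v.adicCompletion K))).fixingSubgroup → σ • e P = e P := by
      intro σ _
      rw [← localPointsEquivTate_smul, hP σ]
    obtain ⟨u, hu, hφ⟩ := hrat ⊥ (e P) hP'
    rw [IntermediateField.mem_bot] at hu
    obtain ⟨x, hx⟩ := hu
    have hx0 : x ≠ 0 := by
      intro h
      apply u.ne_zero
      rw [← hx, h, map_zero]
    refine ⟨Units.mk0 x hx0, ?_⟩
    have hux : Units.map (algebraMap (v.adicCompletion K) (AlgebraicClosure (v.adicCompletion K)) :
        v.adicCompletion K →* AlgebraicClosure (v.adicCompletion K)) (Units.mk0 x hx0) = u :=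
      Units.ext (by simp [hx])
    change e.symm (φ (Additive.ofMul _)) = P
    rw [hux, hφ, AddEquiv.symm_apply_apply]


/-- **A rational `p`-torsion point lies on the Tate line when `p ∤ v(j)`.** At a place `v` of split
multiplicative reduction, let `(q, Φ)` be Tate's uniformisation with `v(q) = v(j(E))⁻¹`
(`exists_tateUniformisation_val_eq`), and assume `v(j(E))` is not a `p`-th power in the value group
(`hj`; i.e. `p ∤ ord_v j(E) = −ord_v(Δ_min)`). Then every `Γ_{K_v}`-fixed `P ∈ E(K̄_v)` with `p·P = 0`
is `Φ(ζ)` for a `p`-th root of unity `ζ ∈ K_v` (given through `K_v → K̄_v`): `P = Φ(u)` with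
`u ∈ K_vˣ` (fixed points), `u^p = q^b`; if `p ∣ b` then `ζ = u·q^{-b/p}`, and if `p ∤ b` then `q`,
hence `v(j)`, would be a `p`-th power. [cite: SilvermanATAEC1994, Thm. V.5.3 and Thm. V.3.1 (c)(d)] -/
theorem exists_rootOfUnity_map_eq_of_fixed {q : v.adicCompletion K}
    {Φ : Additive (AlgebraicClosure (v.adicCompletion K))ˣ →+ localPoints W (v.adicCompletion K)}
    (hq0 : q ≠ 0)
    (hqj : Valued.v q = (Valued.v (algebraMap K (v.adicCompletion K) W.j))⁻¹)
    (hker : ∀ u : (AlgebraicClosure (v.adicCompletion K))ˣ, Φ (Additive.ofMul u) = 0 ↔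
        ∃ n : ℤ, (u : AlgebraicClosure (v.adicCompletion K)) =
          algebraMap (v.adicCompletion K) (AlgebraicClosure (v.adicCompletion K)) q ^ n)
    (hrat : ∀ P : localPoints W (v.adicCompletion K),
        (∀ σ : absoluteGaloisGroup (v.adicCompletion K), σ • P = P) →
        ∃ u : (v.adicCompletion K)ˣ,
          Φ (Additive.ofMul (Units.map (algebraMap (v.adicCompletion K)
            (AlgebraicClosure (v.adicCompletion K)) : v.adicCompletion K →*
              AlgebraicClosure (v.adicCompletion K)) u)) = P)
    (hj : ∀ x : v.adicCompletion K,
      Valued.v (algebraMap K (v.adicCompletion K) W.j) ≠ Valued.v x ^ p)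
    (P : localPoints W (v.adicCompletion K))
    (hP : ∀ σ : absoluteGaloisGroup (v.adicCompletion K), σ • P = P) (hpP : p • P = 0) :
    ∃ ζ : (v.adicCompletion K)ˣ, ζ ^ p = 1 ∧
      Φ (Additive.ofMul (Units.map (algebraMap (v.adicCompletion K)
        (AlgebraicClosure (v.adicCompletion K)) : v.adicCompletion K →*
          AlgebraicClosure (v.adicCompletion K)) ζ)) = P := by
  have hιinj : Function.Injective (Units.map (algebraMap (v.adicCompletion K)
      (AlgebraicClosure (v.adicCompletion K)) : v.adicCompletion K →*
        AlgebraicClosure (v.adicCompletion K))) := fun a b h ↦ Units.ext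
    ((algebraMap (v.adicCompletion K) (AlgebraicClosure (v.adicCompletion K))).injective
      (congrArg Units.val h))
  obtain ⟨u, hu⟩ := hrat P hP
  -- `u^p = q^b`
  have hup : Φ (Additive.ofMul (Units.map (algebraMap (v.adicCompletion K)
      (AlgebraicClosure (v.adicCompletion K)) : v.adicCompletion K →*
        AlgebraicClosure (v.adicCompletion K)) u ^ p)) = 0 := by
    rw [ofMul_pow, map_nsmul, hu, hpP]
  obtain ⟨b, hb⟩ := (hker _).mp hup
  have hb' : u ^ p = Units.mk0 q hq0 ^ b := by
    apply hιinj
    ext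
    rw [Units.coe_map, Units.val_pow_eq_pow_val, map_pow, ← Units.coe_map, ← Units.val_pow_eq_pow_val,
      hb, map_zpow, Units.val_zpow_eq_zpow_val, Units.coe_map, Units.val_mk0]
    rfl
  have hpZ : Prime (p : ℤ) := Nat.prime_iff_prime_int.mp hp.out
  by_cases hpb : (p : ℤ) ∣ b
  · obtain ⟨b', rfl⟩ := hpb
    refine ⟨u * Units.mk0 q hq0 ^ (-b'), ?_, ?_⟩
    · rw [mul_pow, hb', ← zpow_natCast (Units.mk0 q hq0 ^ (-b')), ← zpow_mul, ← zpow_add,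
        show (p : ℤ) * b' + -b' * (p : ℕ) = 0 by ring, zpow_zero]
    · have hq1 : Φ (Additive.ofMul (Units.map (algebraMap (v.adicCompletion K)
          (AlgebraicClosure (v.adicCompletion K)) : v.adicCompletion K →*
            AlgebraicClosure (v.adicCompletion K)) (Units.mk0 q hq0))) = 0 :=
        (hker _).mpr ⟨1, by rw [zpow_one, Units.coe_map, Units.val_mk0]; rfl⟩
      rw [map_mul, map_zpow, ofMul_mul, ofMul_zpow, map_add, map_zsmul, hq1, smul_zero, add_zero, hu]
  · exfalso
    -- `p ∤ b`: `β·b + γ·p = 1`, so `q = (u^β q^γ)^p` and `v(j) = v((u^β q^γ)⁻¹)^p`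
    obtain ⟨β, γ, hβγ⟩ : IsCoprime b (p : ℤ) := ((Prime.coprime_iff_not_dvd hpZ).mpr hpb).symm
    set t : (v.adicCompletion K)ˣ := u ^ β * Units.mk0 q hq0 ^ γ with ht
    have hup' : u ^ (p : ℤ) = Units.mk0 q hq0 ^ b := by rw [zpow_natCast]; exact hb'
    have htp : t ^ (p : ℤ) = Units.mk0 q hq0 := by
      rw [ht, mul_zpow, ← zpow_mul, ← zpow_mul, mul_comm β, zpow_mul, hup', ← zpow_mul, ← zpow_add,
        show b * β + γ * (p : ℕ) = 1 by linear_combination hβγ, zpow_one]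
    have hqt : q = (t : v.adicCompletion K) ^ p := by
      have h := congrArg Units.val htp
      rw [Units.val_zpow_eq_zpow_val, zpow_natCast, Units.val_mk0] at h
      exact h.symm
    refine hj ((t : v.adicCompletion K)⁻¹) ?_
    rw [map_inv₀, inv_pow, ← map_pow, ← hqt, hqj, inv_inv]

end Tate

/-! ## §2. At a KUMMER place the localisation of `[σ ↦ χ(σ)·P̃]` is a Kummer class, for EVERY `χ` -/

section KummerPlace

variable {K : Type} [Field K] [NumberField K] (W : WeierstrassCurve K) [W.IsElliptic] {p : ℕ}
  [hp : Fact p.Prime] (v : HeightOneSpectrum (𝓞 K))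

/-- **The Kummer place lemma.** `E = W` elliptic over a number field `K`, `v` a finite place of
SPLIT multiplicative reduction at which `v(j(E))` is not a `p`-th power in the value group (`hj`:
`p ∤ ord_v j(E) = −ord_v Δ_min`, i.e. `E[p]` is ramified at `v` — the cell's «Kummer support»), and
`P̃ ∈ E[p]` a `Γ_K`-fixed point. Then for EVERY continuous character `χ_v : Γ_{K_v} → ℤ/p` and every
global crossed homomorphism `φ` with `φ(res σ) = χ_v(σ)·P̃` on `Γ_{K_v}`, the localisation
`res_v [φ] ∈ H¹(K_v, E[p])` lies in the local Kummer condition `ker(H¹(K_v, E[p]) → H¹(K_v, E))` —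
whether or not `χ_v` is ramified. Proof: `P̃ = Φ(ζ)` with `ζ ∈ μ_p(K_v)` on the Tate line
(`exists_rootOfUnity_map_eq_of_fixed`), so `σ ↦ χ_v(σ)·P̃ = Φ(ζ^{χ_v(σ)})` takes values in the
image of the roots of unity, and such a cocycle is `σ ↦ σ•Φ(u) − Φ(u)` by continuous Hilbert 90
through the Tate parametrisation (tree: `X2.GreenbergVatsalTateKummerLocal.exists_point_of_values_in_roots`,
Greenberg's «verified quite directly by using the Tate parametrization»). This is the local
mechanism by which Kummer primes carry global Selmer classes with FREE ramification.
[cite: GreenbergLNM1716, §2 pp. 75–76] [cite: SilvermanATAEC1994, Thm. V.5.3 and Thm. V.3.1 (c)(d)]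
[cite: GreenbergVatsal2000, §2 pp. 14–15] -/
theorem res_oneCocycleClass_mem_kummerLocalConditionAt_of_split
    (hsplit : W.HasSplitMultiplicativeReductionAt v)
    (hj : ∀ x : v.adicCompletion K,
      Valued.v (algebraMap K (v.adicCompletion K) W.j) ≠ Valued.v x ^ p)
    (Pt : geomTorsion W (p : ℤ)) (hPt : ∀ σ : absoluteGaloisGroup K, σ • Pt = Pt)
    (χv : absoluteGaloisGroup (v.adicCompletion K) →ₜ* Multiplicative (ZMod p))
    (φ : contOneCocycles (discreteTopRep (absoluteGaloisGroup K) (geomTorsion W (p : ℤ))))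
    (hφ : ∀ σ : absoluteGaloisGroup (v.adicCompletion K),
      φ.1 (resGal (K := K) (v.adicCompletion K) σ) = (Multiplicative.toAdd (χv σ)).val • Pt) :
    galoisCohomology.res (W.torsionGaloisModule (p : ℤ)) (v.adicCompletion K) 1
        (oneCocycleClass (discreteTopRep (absoluteGaloisGroup K) (geomTorsion W (p : ℤ))) φ) ∈
      W.kummerLocalConditionAt (p : ℤ) (v.adicCompletion K) := by
  haveI : NeZero p := ⟨hp.out.ne_zero⟩
  set Kv := v.adicCompletion K with hKv
  -- Tate data with `v(q) = v(j)⁻¹`, and `P̃_loc = Φ(ζ)` with `ζ ∈ μ_p(K_v)`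
  obtain ⟨q, Φ, hq0, hq1, hqj, -, hker, hΦσ, hrat⟩ := exists_tateUniformisation_val_eq W v hsplit
  have hpPg : p • (Pt : geomPoints W) = 0 := AddSubgroup.torsionBy.nsmul_iff.mp Pt.2
  set Ploc : localPoints W Kv := pointsMap W Kv (Pt : geomPoints W) with hPloc
  have hPloc_fix : ∀ σ : absoluteGaloisGroup Kv, σ • Ploc = Ploc := fun σ ↦ by
    rw [hPloc, ← pointsMap_smul W Kv σ (Pt : geomPoints W)]
    congr 1
    exact congrArg Subtype.val (hPt (resGal (K := K) Kv σ))
  have hpPloc : p • Ploc = 0 := by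
    have h := congrArg (pointsMap W Kv) hpPg
    rwa [map_nsmul, map_zero] at h
  obtain ⟨ζ, hζp, hζP⟩ := exists_rootOfUnity_map_eq_of_fixed W v hq0 hqj hker hrat hj Ploc hPloc_fix
    hpPloc
  set ζ' : (AlgebraicClosure Kv)ˣ := Units.map (algebraMap Kv (AlgebraicClosure Kv) :
    Kv →* AlgebraicClosure Kv) ζ with hζ'
  have hζ'p : ζ' ^ p = 1 := by rw [hζ', ← map_pow, hζp, map_one]
  -- the local datum `d τ = χ_v(τ)·P̃ ∈ E[p^∞]`
  let n : absoluteGaloisGroup Kv → ℕ := fun σ ↦ (Multiplicative.toAdd (χv σ)).val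
  have hpPt : p • Pt = 0 := Subtype.ext (by
    rw [AddSubgroupClass.coe_nsmul, ZeroMemClass.coe_zero]; exact hpPg)
  have key : ∀ m : ℕ, (m % p) • Pt = m • Pt := fun m ↦ (nsmul_eq_mod_nsmul m hpPt).symm
  have hn_mul : ∀ g h : absoluteGaloisGroup Kv, n (g * h) • Pt = n g • Pt + n h • Pt := fun g h ↦ by
    simp only [n, map_mul, toAdd_mul]
    rw [ZMod.val_add, key, add_nsmul]
  let ι := AddSubgroup.inclusion (WeierstrassCurve.geomTorsion_le_geomPrimaryTorsion W p)
  let d : (⊤ : Subgroup (absoluteGaloisGroup Kv)) → W.geomPrimaryTorsion p :=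
    fun τ ↦ ι (n (τ : absoluteGaloisGroup Kv) • Pt)
  have hdcoe : ∀ τ : (⊤ : Subgroup (absoluteGaloisGroup Kv)),
      ((d τ : W.geomPrimaryTorsion p) : geomPoints W) = n (τ : absoluteGaloisGroup Kv) • (Pt : geomPoints W) :=
    fun τ ↦ rfl
  have hfixg : ∀ σ : absoluteGaloisGroup Kv,
      resGal (K := K) Kv σ • (Pt : geomPoints W) = Pt := fun σ ↦ by
    rw [← AddSubgroup.torsionBy.coe_smul, hPt]
  have hd : ∀ τ₁ τ₂ : (⊤ : Subgroup (absoluteGaloisGroup Kv)), d (τ₁ * τ₂) = d τ₁ +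
      resGal (K := K) Kv (τ₁ : absoluteGaloisGroup Kv) • d τ₂ := fun τ₁ τ₂ ↦ by
    apply Subtype.ext
    have h1 := congrArg Subtype.val (hn_mul (τ₁ : absoluteGaloisGroup Kv) τ₂)
    simp only [AddSubmonoidClass.coe_nsmul, AddSubgroup.coe_add] at h1
    rw [AddSubgroup.coe_add, primaryComponent.coe_smul, hdcoe, hdcoe, hdcoe, Subgroup.coe_mul, h1,
      smul_comm (resGal (K := K) Kv (τ₁ : absoluteGaloisGroup Kv)), hfixg]
  have hopen : IsOpen {τ : (⊤ : Subgroup (absoluteGaloisGroup Kv)) | d τ = 0} := by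
    have hcont : Continuous fun τ : (⊤ : Subgroup (absoluteGaloisGroup Kv)) ↦
        n (τ : absoluteGaloisGroup Kv) • Pt :=
      (continuous_of_discreteTopology (f := fun x : ZMod p ↦ x.val • Pt)).comp
        (continuous_toAdd.comp (χv.continuous.comp continuous_subtype_val))
    have hset : {τ : (⊤ : Subgroup (absoluteGaloisGroup Kv)) | d τ = 0} =
        (fun τ : (⊤ : Subgroup (absoluteGaloisGroup Kv)) ↦ n (τ : absoluteGaloisGroup Kv) • Pt) ⁻¹'
          {0} := by
      ext τ
      simp only [Set.mem_setOf_eq, Set.mem_preimage, Set.mem_singleton_iff]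
      constructor
      · intro h
        exact AddSubgroup.inclusion_injective _ (h.trans (map_zero ι).symm)
      · intro h
        change ι _ = 0
        rw [h, map_zero]
    rw [hset]
    exact (isOpen_discrete _).preimage hcont
  have hC : ∀ τ : (⊤ : Subgroup (absoluteGaloisGroup Kv)), ∃ ζ'' : (AlgebraicClosure Kv)ˣ,
      IsOfFinOrder ζ'' ∧ Φ (Additive.ofMul ζ'') = pointsMap W Kv (d τ : geomPoints W) := fun τ ↦ by
    refine ⟨ζ' ^ n (τ : absoluteGaloisGroup Kv), ?_, ?_⟩
    · exact isOfFinOrder_iff_pow_eq_one.mpr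
        ⟨p, hp.out.pos, by rw [← pow_mul, mul_comm, pow_mul, hζ'p, one_pow]⟩
    · rw [ofMul_pow, map_nsmul, hζP, hdcoe, map_nsmul]
  have hΨG : ∀ τ : (⊤ : Subgroup (absoluteGaloisGroup Kv)), ∀ u : (AlgebraicClosure Kv)ˣ,
      (τ : absoluteGaloisGroup Kv) • Φ (Additive.ofMul u) =
        Φ (Additive.ofMul (Units.map (Field.absoluteGaloisGroup.toAlgEquiv Kv τ :
          AlgebraicClosure Kv →* AlgebraicClosure Kv) u)) := fun τ u ↦ hΦσ τ u
  have hker' : ∀ u : (AlgebraicClosure Kv)ˣ, Φ (Additive.ofMul u) = 0 →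
      ∃ a : ℤ, (u : AlgebraicClosure Kv) = algebraMap Kv (AlgebraicClosure Kv) q ^ a :=
    fun u h ↦ (hker u).mp h
  -- continuous Hilbert 90 through the Tate parametrisation
  obtain ⟨R, hR⟩ := X2.GreenbergVatsalTateKummerLocal.exists_point_of_values_in_roots W p Φ hker'
    hq0 hq1 ⊤ hΨG d hd hopen hC
  rw [WeierstrassCurve.mem_kummerLocalConditionAt_iff,
    WeierstrassCurve.res_torsionGaloisModule_oneCocycleClass,
    W.map_torsionPointsMapIntertwining_oneCocycleClass (p : ℤ) Kv]
  refine (oneCocycleClass_eq_zero_iff _ _).mpr ⟨R, fun g ↦ ?_⟩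
  have h := hR ⟨g, Subgroup.mem_top g⟩
  rw [hdcoe, map_nsmul] at h
  rw [contOneCocycles.pullback_apply, contOneCocycles.pullback_apply]
  change (W.torsionPointsMapIntertwining (p : ℤ) Kv) (φ.1 (resGal (K := K) Kv g)) = g • R - R
  rw [hφ, map_nsmul, torsionPointsMapIntertwining_apply]
  exact h

end KummerPlace

end Summit.BirchSwinnertonDyer.BirchSwinnertonDyer.Theorems.EisensteinPrimesMazurMCOnCellBKummerPlaceClasses

end
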